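import Summits.ResolutionOfSingularities.ResolutionOfSingularities.Theorems.EquisingularLiftEquisingularLiftNatModelPointStepOfSection
import Summits.ResolutionOfSingularities.ResolutionOfSingularities.Theorems.EquisingularLiftEquisingularLiftNatModelPointStep
import Summits.ResolutionOfSingularities.ResolutionOfSingularities.Theorems.EquisingularLiftEquisingularLiftNatHostTransportPointStep
import Summits.ResolutionOfSingularities.ResolutionOfSingularities.Theorems.EquisingularLiftEquisingularLiftNatLetterTransport
import Summits.ResolutionOfSingularities.ResolutionOfSingularities.Theorems.EquisingularLiftEquisingularLiftNatNestedSectionInModels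
import Summits.ResolutionOfSingularities.ResolutionOfSingularities.Theorems.EquisingularLiftEquisingularLiftNatSubchainSupplierInvSLDefs
import Literature.AlgebraicGeometry.Resolution.AlterationsStrictTransformModel
import HarnessLib

/-!
# [OURS · L1 W4.5(b) · EL♮(3) · WIDTH TABLE D4 «HOSTED NOSE» brick D4-3 (HPT)] THE HOSTED POINT STEP

Desk WIDTH TABLE D4 v0 (2026-08-28), brick D4-3 (res-L1-w45b-stub-4 g11): the `HPT` seam of res-L1-w45b-stub-2's engine K5ʰ
`target_elnat_of_hostedSubchainResolution` — K5′'s point step WITH a host letter transported.  `--supports stmt-ResolutionOfSingularities-20148`, no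
claim, counted 0.  AI-produced; NOT a statement of [Hironaka2017]; EL♮(3) is NOT proved here.

WHAT.
* `disjoint_support_ker_section` — an ideal sheaf whose support misses `s(𝔪)` misses `supp (ker s)` (every point of `Spec O` specialises to `𝔪`).
* ★ `TCPlus.hostedPointStep_of_letterDatum` — at a `Ch`-stage `(X', σ', S')` with model square `j : F₁ → X'` over `Spec θ`, a host letter `E₁`
  (`TCPlus.LetterDatum O P q Y F₁ X' σ' j E₁`: model `𝓛` with reduced trace `𝓘⟨closure E₁⟩`, principal, regular, off `Y`, `O`-flat), a closed point
  `x` of `T̂₁` where `T̂₁` is not regular but `F₁` is, and — only if `x ∈ closure E₁` — `Ẽ₁` regular: the blow-up `υ` of `x` is covered by K5′'s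
  point step (smooth neighbourhood, section `s` through `j x`, `τ₁ = Bl_{ker s}`, new `Ch`-stage, new model square `j₂`, exceptional identity; the
  outputs of `modelPointStep_chain'` VERBATIM) AND the letter steps to `closure (υ⁻¹(E₁ ∖ {x}))` at the new stage.
  OFF the host: `modelPointStep_chain'` + res-type-027's `TCPlus.letterDatum_transport_away`.  ON the host: `𝓛 ≠ ⊥` (by (l-iv) and `Chain.fibre`),
  the special fibre `V(𝓛·𝒪_{F₁}) → V(𝓛)` of the host's model as a model square (`isPullback_of_isClosedImmersion` pasted with `hsq`), a Hensel
  section NESTED in `V(𝓛)` (`exists_nested_section_closedImmersion`, using `Ẽ₁` regular at `x`), the point step with THAT section (K3″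
  `modelPointStep_of_section`, smooth neighbourhood by `goodAt_of_model` / `exists_smooth_nhd_of_goodAt`), `𝓛 ≤ ker s`
  (`IsClosedImmersion.ker_le_ker_of_range_subset`), and (HT1) `hostClauses_strictTransform_of_nestedSection` for the letter's model `St_{τ₁} 𝓛`.
-/

set_option linter.dupNamespace false
set_option linter.overlappingInstances false

noncomputable section

open CategoryTheory CategoryTheory.Limits AlgebraicGeometry TopologicalSpace Topology
open Literature.AlgebraicGeometry.Resolution
open AlgebraicGeometry.Scheme.IdealSheafData
open Summit.ResolutionOfSingularities.ResolutionOfSingularities.Theses.EquisingularLift.Split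
open Summit.ResolutionOfSingularities.ResolutionOfSingularities.Cruxes.EquisingularLift.StrataSplit

namespace Summit.ResolutionOfSingularities.ResolutionOfSingularities.Cruxes.EquisingularLiftNat.Sections

/-! ## (HPT) THE HOSTED POINT STEP: K5′'s point step WITH a host letter transported -/

/-- In a local scheme's section, the support of `ker s` meets only closed sets through `s(𝔪)`: an ideal sheaf whose support misses `s(𝔪)` misses
`supp (ker s)` altogether (every point of `Spec O` specialises to the closed point). [folklore] -/
theorem disjoint_support_ker_section (O : Type) [CommRing O] [IsDomain O] [IsDiscreteValuationRing O] {X' : Scheme.{0}} (r' : X' ⟶ Spec (.of O)) [IsSeparated r'] [IsIntegral X'] [IsLocallyNoetherian X']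
    (s : Spec (.of O) ⟶ X') (hs : s ≫ r' = 𝟙 _) (I : X'.IdealSheafData) (hI : s (IsLocalRing.closedPoint O) ∉ (I.support : Set X')) :
    Disjoint (I.support : Set X') (s.ker.support : Set X') := by
  obtain ⟨_, -, -, hCsupp⟩ := section_isClosedImmersion_and_isRegular_ker O X' r' s hs
  rw [Set.disjoint_iff]
  rintro z ⟨hzI, hzC⟩
  rw [hCsupp] at hzC
  obtain ⟨p', rfl⟩ := hzC
  apply hI
  have hspec : s p' ⤳ s (IsLocalRing.closedPoint O) := (IsLocalRing.specializes_closedPoint p').map s.continuous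
  exact hspec.mem_closed I.support.isClosed hzI


section HostedPointStep

variable (O : Type) [CommRing O] [IsDomain O] [IsDiscreteValuationRing O] [IsAdicComplete (IsLocalRing.maximalIdeal O) O]
    [IsAlgClosed (IsLocalRing.ResidueField O)] (k : Type) [Field k]
    (θ : O →+* k) (hθ : Function.Surjective θ)
    (P : Scheme.{0}) (q : P ⟶ Spec (.of O)) (Y : Set P)
    (Ch : ∀ X' : Scheme.{0}, (X' ⟶ P) → Set X' → Prop)
    (hChStep : ∀ (X' X'' : Scheme.{0}) (σ' : X' ⟶ P) (S' : Set X') (C : X'.IdealSheafData) (τ : X'' ⟶ X'),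
      Ch X' σ' S' → IsBlowup τ C → Scheme.IsRegular C.subscheme → Flat (C.subschemeι ≫ σ' ≫ q) →
      σ' '' (C.support : Set X') ⊆ {y | ¬ IsGenericPoint y Y} → (C.support : Set X') ∩ (σ' ≫ q) ⁻¹' {IsLocalRing.closedPoint O} ⊆ S' →
      Ch X'' (τ ≫ σ') (closure (τ ⁻¹' (S' \ (C.support : Set X')))))
    (hChSplit : ∀ (X' : Scheme.{0}) (σ' : X' ⟶ P) (S' : Set X'), Ch X' σ' S' → Chain P Y X' σ' S')
    (hYsp : Y ⊆ q ⁻¹' {IsLocalRing.closedPoint O}) (hYirr : IsIrreducible Y) (hYcl : IsClosed Y)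
    (hPnoeth : IsLocallyNoetherian P) (hPreg : Scheme.IsRegular P) [IsProper q]

include hθ hChStep hChSplit hYsp hYirr hYcl hPnoeth hPreg

/-- **(HPT) THE HOSTED POINT STEP** (WIDTH TABLE D4 «HOSTED NOSE», brick D4-3; the `HPT` seam of res-L1-w45b-stub-2's engine K5ʰ
`target_elnat_of_hostedSubchainResolution` VERBATIM): K5′'s point step at a non-regular closed point `x` of `T̂₁` where `F₁` is regular
(`modelPointStep_chain'`'s outputs) TOGETHER WITH the transport of a host letter `E₁` (`TCPlus.LetterDatum`) to the strict transform
`closure (υ⁻¹(E₁ ∖ {x}))`: OFF the host (`x ∉ closure E₁`) by res-type-027's `TCPlus.letterDatum_transport_away`; ON the host by a Hensel section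
NESTED in the host's model (`exists_nested_section_closedImmersion`, using `Ẽ₁` regular at `x`), the point step with that section
(`modelPointStep_chain'_of_section`) and (HT1) `hostClauses_strictTransform_of_nestedSection`.  [cite: Liu2002, §8.1 and Thm. 8.1.19]
[cite: GortzWedhorn2020, Prop. 13.91] [OURS · L1 W4.5b · WIDTH TABLE D4 brick D4-3] -/
theorem TCPlus.hostedPointStep_of_letterDatum
    (X' : Scheme.{0}) (σ' : X' ⟶ P) (S' : Set X') (hCh : Ch X' σ' S') (hX'int : IsIntegral X') (hX'noeth : IsLocallyNoetherian X')
    (hX'reg : Scheme.IsRegular X') (hX'dom : IsDominant (σ' ≫ q))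
    (F₁ : Scheme.{0}) (hF₁ : IsIntegral F₁) (j : F₁ ⟶ X') (t : F₁ ⟶ Spec (.of k))
    (hsq : IsPullback j t (σ' ≫ q) (Spec.map (CommRingCat.ofHom θ)))
    (T₁ : Set F₁) (hT₁cl : IsClosed T₁) (hT₁irr : IsIrreducible T₁) (hjT₁ : j '' T₁ = S')
    (E₁ : Set F₁) (hL : TCPlus.LetterDatum O P q Y F₁ X' σ' j E₁)
    (x : ↥(vanishingIdeal (⟨closure T₁, isClosed_closure⟩ : Closeds F₁)).subscheme)
    (hx : IsClosed ({((vanishingIdeal (⟨closure T₁, isClosed_closure⟩ : Closeds F₁)).subschemeι x : F₁)} : Set F₁))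
    (hxreg : ¬ IsRegularLocalRing ((vanishingIdeal (⟨closure T₁, isClosed_closure⟩ : Closeds F₁)).subscheme.presheaf.stalk x))
    (hFreg : IsRegularLocalRing (F₁.presheaf.stalk ((vanishingIdeal (⟨closure T₁, isClosed_closure⟩ : Closeds F₁)).subschemeι x)))
    (hEreg : ((vanishingIdeal (⟨closure T₁, isClosed_closure⟩ : Closeds F₁)).subschemeι x : F₁) ∈ closure E₁ →
      Scheme.IsRegular (vanishingIdeal (⟨closure E₁, isClosed_closure⟩ : Closeds F₁)).subscheme)
    (F₂ : Scheme.{0}) (υ : F₂ ⟶ F₁)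
    (hυ : IsBlowup υ (vanishingIdeal ⟨{((vanishingIdeal (⟨closure T₁, isClosed_closure⟩ : Closeds F₁)).subschemeι x : F₁)}, hx⟩)) :
    IsIntegral F₂ ∧
    IsIrreducible (closure (υ ⁻¹' (T₁ \ {((vanishingIdeal (⟨closure T₁, isClosed_closure⟩ : Closeds F₁)).subschemeι x : F₁)}))) ∧
    ∃ (U : X'.Opens) (s : Spec (.of O) ⟶ X') (X₁ : Scheme.{0}) (τ₁ : X₁ ⟶ X') (j₂ : F₂ ⟶ X₁) (t₂ : F₂ ⟶ Spec (.of k)),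
      Smooth (U.ι ≫ σ' ≫ q) ∧ s ≫ σ' ≫ q = 𝟙 _ ∧ s (IsLocalRing.closedPoint O) ∈ U ∧
      s (IsLocalRing.closedPoint O) = j ((vanishingIdeal (⟨closure T₁, isClosed_closure⟩ : Closeds F₁)).subschemeι x) ∧
      (∀ c ∈ (s.ker.support : Set X'), ¬ IsGenericPoint (σ' c) Y) ∧ IsBlowup τ₁ s.ker ∧ j₂ ≫ τ₁ = υ ≫ j ∧
      (s.ker.comap τ₁).comap j₂ = (vanishingIdeal ⟨{((vanishingIdeal (⟨closure T₁, isClosed_closure⟩ :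
        Closeds F₁)).subschemeι x : F₁)}, hx⟩ : F₁.IdealSheafData).comap υ ∧
      Ch X₁ (τ₁ ≫ σ') (j₂ '' (closure (υ ⁻¹' (T₁ \ {((vanishingIdeal (⟨closure T₁, isClosed_closure⟩ : Closeds F₁)).subschemeι x : F₁)})))) ∧
      IsIntegral X₁ ∧ IsLocallyNoetherian X₁ ∧ Scheme.IsRegular X₁ ∧ IsDominant ((τ₁ ≫ σ') ≫ q) ∧
      IsPullback j₂ t₂ ((τ₁ ≫ σ') ≫ q) (Spec.map (CommRingCat.ofHom θ)) ∧
      TCPlus.LetterDatum O P q Y F₂ X₁ (τ₁ ≫ σ') j₂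
        (closure (υ ⁻¹' (E₁ \ {((vanishingIdeal (⟨closure T₁, isClosed_closure⟩ : Closeds F₁)).subschemeι x : F₁)}))) := by
  classical
  haveI := hX'int; haveI := hX'noeth; haveI := hF₁
  set xF : F₁ := (vanishingIdeal (⟨closure T₁, isClosed_closure⟩ : Closeds F₁)).subschemeι x with hxF
  -- chain facts: properness, a point over the generic point of `Y`
  have hch : Chain P Y X' σ' S' := hChSplit _ _ _ hCh
  obtain ⟨-, -, hσ'⟩ := chain_isRegular P Y X' σ' S' hch hPnoeth hPreg
  haveI := hσ'
  haveI : IsProper (σ' ≫ q) := inferInstance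
  haveI : IsSeparated (σ' ≫ q) := inferInstance
  haveI : IsClosedImmersion (Spec.map (CommRingCat.ofHom θ)) := IsClosedImmersion.spec_of_surjective _ hθ
  haveI hjci : IsClosedImmersion j := MorphismProperty.IsStableUnderBaseChange.of_isPullback hsq.flip inferInstance
  haveI : IsLocallyNoetherian F₁ := LocallyOfFiniteType.isLocallyNoetherian j
  obtain ⟨ξ, hξ⟩ : ∃ ξ : P, IsGenericPoint ξ Y := QuasiSober.sober hYirr hYcl
  obtain ⟨ξ', hfib', -⟩ := Chain.fibre hch hξ
  -- the letter, as a letter on `closure E₁`, and its model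
  have hCl : (⟨closure (closure E₁), isClosed_closure⟩ : Closeds F₁) = ⟨closure E₁, isClosed_closure⟩ := Closeds.ext closure_closure
  have hL' : TCPlus.LetterDatum O P q Y F₁ X' σ' j (closure E₁) := by
    obtain ⟨𝓛, h1, h2, h3, h4, h5⟩ := hL
    exact ⟨𝓛, by rw [hCl]; exact h1, h2, h3, h4, h5⟩
  by_cases hxE : xF ∈ closure E₁
  · ----------------------------------------------------------------
    -- ON THE HOST: nested section in the host's model
    ----------------------------------------------------------------
    obtain ⟨𝓛, hLtr, hLpr, hLreg, hLoff, hLfl⟩ := hL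
    have h𝓛0 : 𝓛 ≠ ⊥ := by
      intro h0
      have hmem : ξ' ∈ (𝓛.support : Set X') := by rw [h0, Scheme.IdealSheafData.support_bot]; trivial
      have hgen : σ' ξ' = ξ := by
        have : ξ' ∈ σ' ⁻¹' {ξ} := by rw [hfib']; exact Set.mem_singleton ξ'
        exact this
      exact hLoff ⟨ξ', hmem, rfl⟩ (hgen ▸ hξ)
    -- the special fibre of the host's model `W = V(𝓛)`
    let ιW := 𝓛.subschemeι
    let iX := (𝓛.comap j).subschemeι
    let jW : (𝓛.comap j).subscheme ⟶ 𝓛.subscheme := Scheme.IdealSheafData.subschemeMap (𝓛.comap j) 𝓛 j (𝓛.le_map_comap j)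
    have hjW : jW ≫ ιW = iX ≫ j := Scheme.IdealSheafData.subschemeMap_subschemeι _ _ _ _
    have hsq1 : IsPullback iX jW j ιW :=
      isPullback_of_isClosedImmersion iX ιW jW j hjW.symm
        (by rw [Scheme.IdealSheafData.ker_subschemeι, Scheme.IdealSheafData.ker_subschemeι])
    have hsqW : IsPullback jW (iX ≫ t) (ιW ≫ σ' ≫ q) (Spec.map (CommRingCat.ofHom θ)) := hsq1.flip.paste_vert hsq
    -- the point of the host's special fibre under `x`
    have hxsupp : xF ∈ ((𝓛.comap j).support : Set F₁) := by
      rw [hLtr, Scheme.IdealSheafData.coe_support_vanishingIdeal]; exact hxE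
    obtain ⟨xW, hxW⟩ : xF ∈ Set.range iX := by rw [Scheme.IdealSheafData.range_subschemeι]; exact hxsupp
    have hxWcl : IsClosed ({xW} : Set (𝓛.comap j).subscheme) := by
      rw [iX.isClosedEmbedding.isClosed_iff_image_isClosed, Set.image_singleton, hxW]; exact hx
    have hregW : IsRegularLocalRing ((𝓛.subscheme).presheaf.stalk (jW xW)) := hLreg _
    have hFWreg : Scheme.IsRegular (𝓛.comap j).subscheme := by
      have h := hEreg hxE
      rw [← hLtr] at h
      exact h
    -- the nested Hensel section
    haveI : Flat (ιW ≫ σ' ≫ q) := hLfl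
    haveI : LocallyOfFinitePresentation (ιW ≫ σ' ≫ q) := locallyOfFinitePresentation_of_isLocallyNoetherian' _
    obtain ⟨s, hs, hsx, -, -, hrange, -, -⟩ :=
      exists_nested_section_closedImmersion O k θ hθ X' 𝓛.subscheme (𝓛.comap j).subscheme (σ' ≫ q) ιW jW (iX ≫ t) hsqW xW hxWcl
        hregW (hFWreg xW)
    have hss₀ : s (IsLocalRing.closedPoint O) = j xF := by
      rw [hsx, ← Scheme.Hom.comp_apply, hjW, Scheme.Hom.comp_apply, hxW]
    have hs' : s ≫ σ' ≫ q = 𝟙 _ := hs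
    -- `xF ∈ T₁`, `T₁ ⊄ {xF}`, `σ' (j xF)` not generic in `Y` (as in `modelPointStep_chain`)
    have hclT₁ : closure T₁ = T₁ := hT₁cl.closure_eq
    have hT₁irr' : IsIrreducible (closure T₁) := by rw [hclT₁]; exact hT₁irr
    have hrangeι : Set.range (vanishingIdeal (⟨closure T₁, isClosed_closure⟩ : Closeds F₁)).subschemeι = closure T₁ := by
      rw [Scheme.IdealSheafData.range_subschemeι, Scheme.IdealSheafData.coe_support_vanishingIdeal]; rfl
    have hxT : xF ∈ T₁ := by rw [← hclT₁, ← hrangeι]; exact ⟨x, rfl⟩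
    have hxgen : ¬ IsGenericPoint xF T₁ := by
      have h := not_isGenericPoint_of_not_isRegularLocalRing (⟨closure T₁, isClosed_closure⟩ : Closeds F₁) hT₁irr' x hxreg
      rwa [show ((⟨closure T₁, isClosed_closure⟩ : Closeds F₁) : Set F₁) = T₁ from hclT₁] at h
    have hTx : ¬ T₁ ⊆ {xF} := not_subset_singleton_of_not_isGenericPoint hT₁cl hxT hxgen
    have hw : ¬ IsGenericPoint (σ' (j xF)) Y := by
      obtain ⟨ξ'', hfib'', hS''⟩ := Chain.fibre hch hξ
      intro hgen
      have h1 : σ' (j xF) = ξ := hgen.eq hξ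
      have h2 : j xF = ξ'' := by
        have : j xF ∈ σ' ⁻¹' {ξ} := h1
        rw [hfib''] at this
        simpa using this
      have h3 : IsGenericPoint (j xF) (j '' T₁) := by rw [hjT₁, h2, isGenericPoint_def, hS'']
      exact hxgen (isGenericPoint_of_isClosedEmbedding hjci.isClosedEmbedding h3)
    -- a smooth neighbourhood of `j xF` (good reduction read through the model)
    have hrangej' : Set.range j = (σ' ≫ q) ⁻¹' {IsLocalRing.closedPoint O} := by
      rw [range_eq_preimage_of_isPullback hsq, range_specMap_of_surjective_of_field θ hθ]
    have hr'w₁ : (σ' ≫ q) (j xF) = IsLocalRing.closedPoint O := by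
      have : j xF ∈ Set.range j := ⟨xF, rfl⟩
      rw [hrangej'] at this
      exact this
    have hga : GoodAt (σ' ≫ q) (j xF) := goodAt_of_model O k θ hθ X' F₁ (σ' ≫ q) hX'reg j t hsq xF hFreg
    have hflat : Flat (σ' ≫ q) := flat_of_isIntegral_of_isDominant (σ' ≫ q)
    haveI : LocallyOfFinitePresentation (σ' ≫ q) := locallyOfFinitePresentation_of_isLocallyNoetherian' (σ' ≫ q)
    obtain ⟨U, hw₁U, hU⟩ := exists_smooth_nhd_of_goodAt O X' (σ' ≫ q) inferInstance hflat (j xF) hr'w₁ hga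
    have hsU : s (IsLocalRing.closedPoint O) ∈ U := hss₀ ▸ hw₁U
    -- the point step with THIS section (K3″ `modelPointStep_of_section`)
    obtain ⟨X₁, τ₁, hτ₁⟩ := exists_isBlowup X' s.ker
    obtain ⟨hCh₁, hreg₁, hLN, hint, hdom₁, hF₂, hT₂irr, hJ, hsoff, -, -, j₂, t₂, hsq₂, hcomm, hexc, hsets⟩ :=
      modelPointStep_of_section O k θ hθ P q Y hYsp hYirr hYcl Ch hChSplit hChStep X' σ' S' hCh hX'reg hX'dom F₁ j t hsq T₁ hjT₁ xF hx
        hxT hTx hw s hs' hss₀ X₁ τ₁ hτ₁ F₂ υ hυ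
    -- the host contains the section
    have hle : 𝓛 ≤ s.ker := by
      have h := Literature.AlgebraicGeometry.Resolution.IsClosedImmersion.ker_le_ker_of_range_subset ιW s hrange
      rwa [Scheme.IdealSheafData.ker_subschemeι] at h
    haveI := hint; haveI := hLN; haveI := hF₂
    haveI : IsLocallyNoetherian F₂ := hυ.isLocallyNoetherian
    obtain ⟨hr, hp, hf, -, htr⟩ := hostClauses_strictTransform_of_nestedSection O k θ hθ σ' q hX'reg j t hsq s hs' τ₁ hτ₁ υ j₂ hcomm xF hx hυ
      hJ hss₀ 𝓛 hle h𝓛0 hLreg hLpr hLfl (closure E₁) isClosed_closure hLtr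
    refine ⟨hF₂, hT₂irr, U, s, X₁, τ₁, j₂, t₂, hU, hs', hsU, hss₀, hsoff, hτ₁, hcomm, hexc, ?_, hint, hLN, hreg₁, hdom₁, hsq₂,
      strictTransformIdeal τ₁ s.ker 𝓛, ?_, hp, hr, ?_, hf⟩
    · rw [hsets]; exact hCh₁
    · rw [htr]
      congr 1
      apply Closeds.ext
      change closure (υ ⁻¹' (closure E₁ \ {xF})) = closure (closure (υ ⁻¹' (E₁ \ {xF})))
      rw [closure_closure, closure_preimage_closure_diff_singleton hx hυ E₁]
    · rintro _ ⟨c, hc, rfl⟩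
      have hc' : τ₁ c ∈ (𝓛.support : Set X') := apply_mem_support_of_mem_support_strictTransformIdeal 𝓛 hc
      exact hLoff ⟨τ₁ c, hc', (Scheme.Hom.comp_apply τ₁ σ' c).symm⟩
  · ----------------------------------------------------------------
    -- OFF THE HOST: K5′'s point step, the letter transported away
    ----------------------------------------------------------------
    obtain ⟨hF₂, hT₂irr, U, s, X₁, τ₁, j₂, t₂, -, hU, hs₁, hsU, hss₀, hsoff, hτ₁, hcomm, hexc, hCh₁, hint, hLN, hreg₁, hdom₁, hsq₂⟩ :=
      modelPointStep_chain' O k θ hθ P q Y hYsp hYirr hYcl hPnoeth hPreg Ch hChSplit hChStep X' σ' S' hCh hX'reg hX'dom F₁ j t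
        hsq T₁ hT₁cl hT₁irr hjT₁ x hx hxreg hFreg F₂ υ hυ
    refine ⟨hF₂, hT₂irr, U, s, X₁, τ₁, j₂, t₂, hU, hs₁, hsU, hss₀, hsoff, hτ₁, hcomm, hexc, hCh₁, hint, hLN, hreg₁, hdom₁, hsq₂, ?_⟩
    have hJsupp : ((vanishingIdeal ⟨{xF}, hx⟩ : F₁.IdealSheafData).support : Set F₁) = {xF} := by
      rw [Scheme.IdealSheafData.coe_support_vanishingIdeal]; rfl
    have hdisj : ∀ I : X'.IdealSheafData, j xF ∉ (I.support : Set X') → Disjoint (I.support : Set X') (s.ker.support : Set X') :=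
      fun I hI => disjoint_support_ker_section O (σ' ≫ q) s hs₁ I (hss₀ ▸ hI)
    have h := TCPlus.letterDatum_transport_away O P q Y hτ₁ hυ hJsupp hcomm hdisj isClosed_closure hL' hxE
    rwa [closure_preimage_closure_diff_singleton hx hυ E₁] at h

end HostedPointStep

end Summit.ResolutionOfSingularities.ResolutionOfSingularities.Cruxes.EquisingularLiftNat.Sections

end
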